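import Summits.Ventures.GridStability.Lyapunov.LffLevelNonempty
import Summits.Ventures.GridStability.Models.NE39LPostCase3
import HarnessLib

/-!
# GridStability/Lyapunov/NE39LPostCase3Lff — LFF-P2-FC row «NE39L-post-case3»: the solver-free closed-form
# Vu–Turitsyn certificate (every λ), its EXPLICIT rational level, synchronisation, and non-emptiness

Cell `gridfusion` (LADDER-GRIDFUSION), LFF lane, fault-coverage track «LFF-P2-FC NE39L cases 3–6» (lead ruling
R-LFF-FC-NE39L 2026-08-27T04:41:51Z / 05:10:01Z: «Models (model-4) ∧ Lean Lyapunov side (lyap-1: LffLevelNonempty-pattern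
level rows)»); seat gridfusion-lyap-1 (g4); namespace `Summit.Ventures.GridStability.Lyapunov.NE39LPostCase3Lff`.
LABEL OF EVERY MENTION (inherited from NE39L): «synthetic VARIANT (conductances dropped, lossless REDISPATCH at the
post-fault operating angles of Padiyar Table 4.1 case 3, line 26-28 removed) — not a sentence about the printed New England
system»; tokens MV-2 post-fault network of case 3 + MV-2L + MV-RD + MV-λ + MV-h12 + MV-E6.

INPUTS. model-4's typed object `Models/NE39LPostCase3.lean` (`NE39LPostCase3.data : RecastData 9` = `NE39L.data` with the
post-fault couplings `K^B` and circle points; `data_Cc_pos`, `data_B_symm`, `data_eqData`, `data_circle`, the hypothesis-free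
bridge `hasDerivWithinAt_lffState_lines`, certified node tables `angleLo ≤ θ* ≤ angleHi` with their decidable tests
`angleLo_test` / `angleHi_test`); lyap-1's generic machinery `RelativeLffClosedForm(Lines).lean` (p488216 / p493112:
`RelativeLff.certU`, `wellU_subset_regionOfAttraction_of_level`, `synchronisationU_of_level`, `levelBoundQ`) and
`LffLevelNonempty.lean` (p496343: `eqTermLo`, `certU_V_zero_lt_of_level`, `zero_mem_polytope_of_abs_lt`).

CERTIFIED HERE (kernel, `decide` over `ℚ`; the inertia facts are NE39L's, re-decided on this object): `M_i > 0`,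
`ν = 1/10 < M′_m`, the scalar PSD criterion `Σ M′²/(M′ − 1/10) ≤ S` (⇒ Sherman–Morrison `N⁻¹ ⪰ (1/10)·1`); acute circle
points; ONE rational `L_U = -66.559` below every line's `levelBoundQ` (weights `K^B_ij`, model-4's tables; `decide`); ONE
rational comparison `−Σ K^B·eqTermLo < L_U` (non-emptiness, margin 0.2029 per model-4's exact pre-check).
CONSEQUENCES, for EVERY damping ratio `λ > 0` (`c′ = 2/λ + λ/2`): `certU lam` is a Vu–Turitsyn certificate of
`NE39LPostCase3.lffSystemU lam` [cite: VuTuritsyn2016, §III eq. (QKH)]; `levelU_roa`: for every `c₀ < c′·L_U` the set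
`{x ∈ 𝒫 | V_λ x ≤ c₀}` is positively invariant and every global solution from it tends to `0` [cite: VuTuritsyn2016, §IV set ℛ];
`levelU_synchronisation`: every solution of `data.toModelRel lam a′` starting in it has `(δ_m − δ_0) − (θ*_m − θ*_0) → 0`,
`ω_m − ω_0 → 0` (synchronisation with GEN 2); `V_zero_lt_levelU` + `zero_mem_polytopeU` + `levelU_nonempty`: the level
interval `[V_λ(0), c′·L_U)` is non-empty and every such certified set contains the post-fault equilibrium.
THREE COLUMNS. CERTIFIED: these rational facts and sentences, for MODEL M′. MODELLED: as LABEL. VALIDATED: nothing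
(Padiyar's printed critical clearing time of case 3 is a comparator elsewhere, never merged). No sentence of this file
says that the New England system or any grid is stable. Definitions `certU`, `L_U` (bookkeeping); no named fact;
standard axioms; NO SDP, no solver anywhere in the chain.
-/

noncomputable section

open Set Filter Topology Real
open Literature.MathematicalPhysics.PowerSystems
open Literature.MathematicalPhysics.PowerSystems.LyapunovFunctionFamily
open Literature.MathematicalPhysics.PowerSystems.ClassicalModel.LosslessSystem (vtGap)
open Summit.Ventures.GridStability.Models
open Summit.Ventures.GridStability.Lyapunov.RelativeLff

namespace Summit.Ventures.GridStability.Lyapunov.NE39LPostCase3Lff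

/-! ### Instance facts (the inertias are NE39L's; the circle points are the post-fault ones) -/

/-- All ten inertias are positive (NE39L's inertias). -/
theorem M_pos : ∀ i : Fin 10, 0 < NE39LPostCase3.data.M i := by decide +kernel

/-- `ν = 1/10 < M′_m` (NE39L's inertias; same decide as `NE39LLff.nu_lt_Mμ`). -/
theorem nu_lt_Mμ : ∀ m : Fin 9, (1 / 10 : ℝ) < Mμ NE39LPostCase3.data m := by
  have hq : ∀ m : Fin 9, (1 / 10 : ℚ) < NE39LPostCase3.data.M m.succ := by decide +kernel
  intro m
  unfold Mμ
  rw [show (1 / 10 : ℝ) = ((1 / 10 : ℚ) : ℝ) by norm_num]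
  exact Rat.cast_lt.2 (hq m)

/-- The scalar PSD criterion at `ν = 1/10`: `Σ_m M′_m²/(M′_m − 1/10) ≤ S = M_0 + Σ_m M′_m` (NE39L's inertias;
same decide as `NE39LLff.cs_criterion`). -/
theorem cs_criterion :
    ∑ m, Mμ NE39LPostCase3.data m ^ 2 / (Mμ NE39LPostCase3.data m - 1 / 10) ≤ S NE39LPostCase3.data := by
  have hq : ∑ m : Fin 9, NE39LPostCase3.data.M m.succ ^ 2 / (NE39LPostCase3.data.M m.succ - 1 / 10)
      ≤ NE39LPostCase3.data.M 0 + ∑ m : Fin 9, NE39LPostCase3.data.M m.succ := by decide +kernel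
  have h := (Rat.cast_le (K := ℝ)).2 hq
  unfold S Mμ Mref
  push_cast at h
  exact h

/-- Acute post-fault circle points: `s_i ≥ 0` and `c_i > 0`. -/
theorem acute : (∀ i : Fin 10, 0 ≤ NE39LPostCase3.data.s i) ∧ ∀ i : Fin 10, 0 < NE39LPostCase3.data.c i :=
  ⟨NE39LPostCase3.data_s_nonneg, NE39LPostCase3.data_c_pos⟩

/-! ### The closed-form certificate, explicit level, region and synchronisation (every λ) -/

/-- **The closed-form Vu–Turitsyn certificate of «NE39L-post-case3» on the 45-line presentation**, every `λ > 0`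
(`ν = 1/10`, Sherman–Morrison `N⁻¹`, `c = 1`, `g = λ/2`, `c′ = 2/λ + λ/2`). [cite: VuTuritsyn2016, §III eq. (QKH)] -/
def certU (lam : ℚ) (hlam : 0 < lam) :=
  RelativeLff.certU NE39LPostCase3.data lam hlam NE39LPostCase3.data.angleOf (ν := 1 / 10) (by norm_num) M_pos
    nu_lt_Mμ cs_criterion NE39LPostCase3.data_Cc_pos

/-- The explicit level constant `L_U = -66.559` (model-4's packet value, re-checked here in the kernel). -/
def L_U : ℚ := -66559 / 1000

/-- `L_U` lies below every line's rational level functional (weights `K^B_ij`, model-4's node tables). -/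
theorem L_U_le : ∀ k, L_U ≤ levelBoundQ NE39LPostCase3.data (wuq NE39LPostCase3.data)
    NE39LPostCase3.angleLo NE39LPostCase3.angleHi k := by
  decide +kernel

/-- **Explicit-level region, every `λ > 0`**: for every `c₀ < (2/λ + λ/2)·L_U` and every `y ∈ 𝒫` with `V_λ y ≤ c₀`, a
global solution of `NE39LPostCase3.lffSystemU lam` exists and EVERY global solution keeps `{𝒫, V_λ ≤ c₀}` and tends
to `0`. MODELLED: synthetic lossless redispatched uniform-λ variant, post-fault network of case 3.
[cite: VuTuritsyn2016, §IV set ℛ] -/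
theorem levelU_roa (lam : ℚ) (hlam : 0 < lam) {c₀ : ℝ}
    (hc₀ : c₀ < (2 / (lam : ℝ) + (lam : ℝ) / 2) * (L_U : ℝ)) {y : Fin 9 ⊕ Fin 9 → ℝ}
    (hy : y ∈ (NE39LPostCase3.data.lffSystemU lam NE39LPostCase3.data.angleOf).polytope)
    (hyc : (certU lam hlam).V y ≤ c₀) :
    (∃ X : ℝ → Fin 9 ⊕ Fin 9 → ℝ, X 0 = y ∧
        ∀ T : ℝ, ∀ t ∈ Icc 0 T, HasDerivWithinAt X
          ((NE39LPostCase3.data.lffSystemU lam NE39LPostCase3.data.angleOf).field (X t)) (Icc 0 T) t) ∧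
      ∀ X : ℝ → Fin 9 ⊕ Fin 9 → ℝ, X 0 = y →
        (∀ T : ℝ, ∀ t ∈ Icc 0 T, HasDerivWithinAt X
          ((NE39LPostCase3.data.lffSystemU lam NE39LPostCase3.data.angleOf).field (X t)) (Icc 0 T) t) →
        (∀ t, 0 ≤ t → X t ∈ (NE39LPostCase3.data.lffSystemU lam NE39LPostCase3.data.angleOf).polytope ∧
            (certU lam hlam).V (X t) ≤ c₀) ∧
          Tendsto X atTop (𝓝 0) :=
  wellU_subset_regionOfAttraction_of_level NE39LPostCase3.data lam hlam _ M_pos nu_lt_Mμ cs_criterion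
    NE39LPostCase3.data_Cc_pos NE39LPostCase3.data_eqData NE39LPostCase3.data_circle.1 acute.1 acute.2
    NE39LPostCase3.angleLo NE39LPostCase3.angleHi NE39LPostCase3.angleLo_test NE39LPostCase3.angleHi_test
    L_U_le hc₀ hy hyc

/-- **Explicit-level synchronisation, every `λ > 0`**, read on `NE39LPostCase3.data.toModelRel lam a′` (hypothesis-free:
lossless, reciprocal, exact A1 data): every solution whose initial relative state lies in `{𝒫, V_λ ≤ c₀}`,
`c₀ < (2/λ + λ/2)·L_U`, keeps it and has `(δ_m − δ_0) − (θ*_m − θ*_0) → 0`, `ω_m − ω_0 → 0` — all nine machines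
synchronise with GEN 2 at the post-fault angles. [cite: VuTuritsyn2016, §IV set ℛ; SauerPai1998, §6.10] -/
theorem levelU_synchronisation (lam : ℚ) (hlam : 0 < lam) (a : ℝ) {c₀ : ℝ}
    (hc₀ : c₀ < (2 / (lam : ℝ) + (lam : ℝ) / 2) * (L_U : ℝ)) {c : ℝ → ClassicalSwing.State 10}
    (hsol : (NE39LPostCase3.data.toModelRel lam a).IsSolutionOn c univ)
    (hy : RecastData.lffState NE39LPostCase3.data.angleOf (c 0) ∈
      (NE39LPostCase3.data.lffSystemU lam NE39LPostCase3.data.angleOf).polytope)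
    (hyc : (certU lam hlam).V (RecastData.lffState NE39LPostCase3.data.angleOf (c 0)) ≤ c₀) :
    (∀ t, 0 ≤ t → RecastData.lffState NE39LPostCase3.data.angleOf (c t) ∈
          (NE39LPostCase3.data.lffSystemU lam NE39LPostCase3.data.angleOf).polytope ∧
          (certU lam hlam).V (RecastData.lffState NE39LPostCase3.data.angleOf (c t)) ≤ c₀) ∧
      Tendsto (fun t => RecastData.lffState NE39LPostCase3.data.angleOf (c t)) atTop (𝓝 0) :=
  synchronisationU_of_level NE39LPostCase3.data lam hlam a NE39LPostCase3.data_transferConductance_eq_zero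
    NE39LPostCase3.data_B_symm _ M_pos nu_lt_Mμ cs_criterion NE39LPostCase3.data_Cc_pos
    NE39LPostCase3.data_eqData NE39LPostCase3.data_circle.1 acute.1 acute.2 NE39LPostCase3.angleLo
    NE39LPostCase3.angleHi NE39LPostCase3.angleLo_test NE39LPostCase3.angleHi_test L_U_le hc₀ hsol hy hyc

/-- The system certified here IS model-4's `NE39LPostCase3.lffSystemU lam` (definitional bookkeeping). -/
theorem lffSystemU_eq (lam : ℚ) :
    NE39LPostCase3.lffSystemU lam = NE39LPostCase3.data.lffSystemU lam NE39LPostCase3.data.angleOf := rfl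

/-! ### Non-emptiness: the post-fault equilibrium lies in every admissible certified set -/

/-- ONE rational comparison: `−Σ_k K^B_k·eqTermLo_k < L_U`. -/
theorem neg_sum_eqTermLo_lt_L_U :
    -(∑ k : RecastData.LffLine 9, wuq NE39LPostCase3.data k *
        eqTermLo NE39LPostCase3.data NE39LPostCase3.angleLo NE39LPostCase3.angleHi k.1.1 k.1.2) < L_U := by
  decide +kernel

/-- **Non-emptiness of the level row, every `λ > 0`**: `V_λ(0) < (2/λ + λ/2)·L_U`. [folklore] -/
theorem V_zero_lt_levelU (lam : ℚ) (hlam : 0 < lam) :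
    (certU lam hlam).V 0 < (2 / (lam : ℝ) + (lam : ℝ) / 2) * (L_U : ℝ) :=
  certU_V_zero_lt_of_level NE39LPostCase3.data lam hlam _ M_pos nu_lt_Mμ cs_criterion NE39LPostCase3.data_Cc_pos
    NE39LPostCase3.data_eqData NE39LPostCase3.data_circle.1 acute.1 acute.2 NE39LPostCase3.angleLo
    NE39LPostCase3.angleHi NE39LPostCase3.angleLo_test NE39LPostCase3.angleHi_test neg_sum_eqTermLo_lt_L_U

/-- The post-fault synchronous equilibrium (relative state `0`) lies in the polytope. -/
theorem zero_mem_polytopeU (lam : ℚ) :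
    (0 : Fin 9 ⊕ Fin 9 → ℝ) ∈ (NE39LPostCase3.data.lffSystemU lam NE39LPostCase3.data.angleOf).polytope :=
  zero_mem_polytope_of_abs_lt _ (abs_δsu_lt_of_acute NE39LPostCase3.data acute.1 acute.2)

/-- **Rider for `levelU_roa` / `levelU_synchronisation`**: an admissible level whose certified set contains the
equilibrium exists (witness `c₀ = V_λ(0)`). -/
theorem levelU_nonempty (lam : ℚ) (hlam : 0 < lam) :
    ∃ c₀ : ℝ, c₀ < (2 / (lam : ℝ) + (lam : ℝ) / 2) * (L_U : ℝ) ∧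
      (0 : Fin 9 ⊕ Fin 9 → ℝ) ∈ (NE39LPostCase3.data.lffSystemU lam NE39LPostCase3.data.angleOf).polytope ∧
      (certU lam hlam).V 0 ≤ c₀ :=
  ⟨_, V_zero_lt_levelU lam hlam, zero_mem_polytopeU lam, le_rfl⟩

end Summit.Ventures.GridStability.Lyapunov.NE39LPostCase3Lff

end
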